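import Mathlib
import Literature.Geometry.Lorentzian.IPlusRegular
import Literature.Geometry.Lorentzian.Einstein
import HarnessLib

/-!
# The norm of the stationary Killing field at spatial infinity of a vacuum `I⁺`-regular black
hole: `g(T,T) → -v_∞ < 0` from above, uniformly modulo the stationary flow
(named fact, D-0014; topic `Literature/Geometry/Lorentzian`)

Printed sources.  (1) P. T. Chruściel, J. L. Costa, *On uniqueness of stationary vacuum black
holes*, Astérisque **321** (2008) 195–265 = arXiv:0806.0016, **§2.1**: along the asymptotically flat
end, for a Killing vector `X = N n + Y` timelike along `Σ_ext` and data satisfying the requirements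
of the positive energy theorem, "`(N, Yⁱ) →_{r→∞} (A⁰, Aⁱ)`, where the `A^μ`'s are constants
satisfying `(A⁰)² > Σᵢ (Aⁱ)²`. One can then choose adapted coordinates so that the metric can,
locally, be written as `⁴g = -V²(dt + θᵢdxⁱ)² + γᵢⱼdxⁱdxʲ`, with `∂ₜV = ∂ₜθ = ∂ₜγ = 0`,
`γᵢⱼ - δᵢⱼ = O_k(r^{-α})`, `θᵢ = O_k(r^{-α})`, `V - 1 = O_k(r^{-α})`, for any `k ∈ ℕ`" and, for
vacuum metrics, "the leading order corrections in the metric can be written in a Schwarzschild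
form, which in 'isotropic' coordinates reads
`g_m = -((1 - m/2|x|^{n-2})/(1 + m/2|x|^{n-2}))² dt² + (1 + m/2|x|^{n-2})^{4/(n-2)} Σ dxᵢ²`, where
`m ∈ ℝ`"; **§2.2**, footnote: "in the literature it is always implicitly assumed that `X` is
uniformly timelike in the asymptotic region `Σ_ext`, by this we mean that `⁴g(X, X) < -ε < 0` for
some `ε` and for all `r` large enough … uniformity always holds for Killing vectors which are
timelike for all large distances if the conditions of the positive energy theorem are met
[Beig–Chruściel 1996, Chruściel–Maerten 2006]" (verbatim also in Chruściel–Costa–Heusler, Living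
Rev. Relativity 15 (2012) 7, **§2.3**); **§4.2**, Prop. 4.4 and Thm. 4.5 with (4.11):
`⟨⟨M_ext⟩⟩ ≈ ℝ × (𝒞⁺ ∪ Σ_ext)` with `closure 𝒞⁺` compact, under the standing hypothesis of one
asymptotically flat end (§6.2: "which is necessarily the case under the hypotheses of Theorem 2.3"),
the flow of `X` being translation along `ℝ` — so that the complement in `⟨⟨M_ext⟩⟩` of the orbit
of a compact subset of `⟨⟨M_ext⟩⟩ ∪ 𝓔⁺` under the stationary flow is (contained in) the asymptotic
region `{r > R}` of `M_ext = ⋃ₜ φₜ(Σ_ext)`.  (2) R. Beig, P. T. Chruściel, J. Math. Phys. 37 (1996)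
1939–1961 = gr-qc/9510015, **Prop. 3.1–3.2** (for an asymptotically translational Killing vector,
`X^μ → A^μ`, "if `A^μ A_μ ≥ 0`, then the ADM four-momentum `p^μ` vanishes; if `A^μA_μ < 0`, then
`p^μ` is proportional to `A^μ`") and **Thm. 1.2** (timelike future-pointing four-momentum).
(3) R. Beig, Phys. Lett. A 69 (1978) 153–155: the ADM energy of a stationary space-time is read off
from `g₀₀ = -1 + 2m/r + o(1/r)` (the constant `m` of (1)).  (4) G. W. Gibbons, S. W. Hawking,
G. T. Horowitz, M. J. Perry, Commun. Math. Phys. 88 (1983) 295–308: the positive mass theorem for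
black holes — for data on a hypersurface with inner boundary on (apparent) horizons, satisfying the
dominant energy condition, the ADM mass is positive (`m > 0`; `m = 0` only for flat data, which
carry no horizon).

CONSEQUENCE RECORDED HERE (weaker than the conjunction of (1)–(4)).  In the adapted coordinates of
(1) the fixed stationary field `T = 𝓑.killing` of the tree (complete, timelike on `M_ext`, NOT
normalised) is `X = ∂ₜ` up to the constant factor fixed by `A^μ`, so
`⁴g(T, T) = -v_∞ V² = -v_∞ (1 - 2m/r + O(r^{-2}))` with `v_∞ := (A⁰)² - Σ(Aⁱ)² > 0` and `m > 0`:
hence `⁴g(T,T) → -v_∞` at spatial infinity and `⁴g(T,T) > -v_∞` for all large `r` (the sign of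
`m`), uniformly in Killing time.  Rendered flow-invariantly, without coordinates: there is `v > 0`
such that for every `ε > 0` the two-sided bound `-v < ⁴g(T,T) < -v + ε` holds on the d.o.c. outside
the stationary orbit `⋃ₜ φₜ(S)` of some compact `S ⊆ ⟨⟨M_ext⟩⟩ ∪ 𝓔⁺` (`stationaryOrbit`, as in the
tree's cruxes: "compact modulo the stationary flow").  In particular `T` is uniformly timelike near
infinity (take `ε < v`), and every level set `{⁴g(T,T) = -w} ∩ ⟨⟨M_ext⟩⟩`, `w > 0`, avoids a
neighbourhood of infinity.  Hypotheses as for the tree's companion fact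
`chruscielCosta2008_docProductStructure` (vacuum — the field equations behind the expansion of (1)
and the energy condition of (2), (4) —, `I⁺`-regular, simply connected d.o.c., connected non-empty
horizon: one asymptotically flat end and a genuine black hole, so that `m > 0`).
Not vendored: the expansion itself, the adapted coordinates, the value `m = M_ADM`, decay rates.
-- TODO(general form): the asymptotic expansion of stationary vacuum ends (CC08 §2.1; Beig–Simon
-- 1980/81) in adapted coordinates, electro-vacuum, higher dimensions, several ends.

Used by the crux `NonTrappingHawkingRigidity` of the summit `FinalStateConjecture` (line
`azimuthal-partial-analyticity`, stub `stub_farAxialSeed`: level sets of `⁴g(T,T)` in the d.o.c.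
are compact modulo the stationary flow, which confines the orbits of a `T`-commuting Killing field
and makes its flow complete on the `T`-timelike region).

## References
* P. T. Chruściel, J. L. Costa, Astérisque 321 (2008), arXiv:0806.0016, §2.1, §2.2 (footnote on
  uniform timelikeness), Prop. 4.4, Thm. 4.5, §6.2. [ChruscielCosta2008]
* P. T. Chruściel, J. L. Costa, M. Heusler, Living Rev. Relativity 15 (2012) 7, arXiv:1205.6112,
  §2.3. [ChruscielCostaHeusler2012]
* R. Beig, P. T. Chruściel, J. Math. Phys. 37 (1996) 1939–1961, gr-qc/9510015, Prop. 3.1–3.2,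
  Thm. 1.2. [BeigChrusciel1996]
* R. Beig, Phys. Lett. A 69 (1978) 153–155. [Beig1978]
* G. W. Gibbons, S. W. Hawking, G. T. Horowitz, M. J. Perry, Commun. Math. Phys. 88 (1983)
  295–308. [GibbonsHawkingHorowitzPerry1983]
-/

noncomputable section

open Bundle Set
open scoped Manifold ContDiff Topology

namespace Literature.Geometry.Lorentzian

/-- **The stationary Killing field is uniformly timelike at spatial infinity, with `⁴g(T,T)`
tending to its limit `-v < 0` strictly from above, uniformly modulo the stationary flow**
(Chruściel–Costa 2008, §2.1–2.2 with the positive mass theorem for black holes: in adapted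
coordinates on the end `⁴g(T,T) = -v(1 - 2m/r + O(r^{-2}))`, `v = (A⁰)² - |A|² > 0`
(Beig–Chruściel 1996, Prop. 3.1–3.2), `m = M_ADM > 0` (Beig 1978; Gibbons–Hawking–Horowitz–Perry
1983); the far region is the complement of the stationary orbit of a compact set by the
one-ended product structure, Chruściel–Costa Thm. 4.5 / Prop. 4.4 / §6.2).  For a vacuum,
`I⁺`-regular stationary asymptotically flat black hole with simply connected d.o.c. and connected
horizon: there is `v > 0` such that for every `ε > 0` there is a compact `S ⊆ ⟨⟨M_ext⟩⟩ ∪ 𝓔⁺` with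
`-v < ⁴g(T,T)(x) < -v + ε` at every point `x` of the d.o.c. outside `⋃ₜ φₜ(S)`.  Consequence of the
printed statements as explained in the module docstring.
[cite: ChruscielCosta2008, §2.1–2.2 (asymptotics of stationary ends; uniform timelikeness) and Thm. 4.5]
[cite: ChruscielCostaHeusler2012, §2.3] [cite: BeigChrusciel1996, Prop. 3.1–3.2 and Thm. 1.2]
[cite: Beig1978, main formula] [cite: GibbonsHawkingHorowitzPerry1983, Thm. (positive mass for black holes)] -/
def chruscielCosta2008_stationaryNormAtInfinity : Prop :=
  ∀ (𝓑 : StationaryAFBlackHole.{0}) [𝓑.metric.HasLeviCivita],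
    𝓑.metric.toPseudoRiemannianMetric.IsRicciFlat → 𝓑.IsIPlusRegular →
    SimplyConnectedSpace 𝓑.doc → IsConnected 𝓑.horizon →
    ∃ v : ℝ, 0 < v ∧ ∀ ε : ℝ, 0 < ε →
      ∃ S : Set 𝓑.carrier, IsCompact S ∧ S ⊆ 𝓑.doc ∪ 𝓑.horizon ∧
        ∀ x ∈ 𝓑.doc, x ∉ stationaryOrbit 𝓑.killing S →
          -v < 𝓑.metric.val x (𝓑.killing x) (𝓑.killing x) ∧
            𝓑.metric.val x (𝓑.killing x) (𝓑.killing x) < -v + ε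

end Literature.Geometry.Lorentzian

end
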